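import Summits.FinalStateConjecture.FinalStateConjecture.Theorems.EIHFluxBalanceInertialRecessionVirialCold

/-!
# Route EIHFluxBalance — crux `InertialRecession`, abstract endgame for general `N`:
# a group whose internal energy tends to zero has convergent member velocities

Helper file for the crux `stmt-FinalStateConjecture-10166` (virial route, evidence note
`InertialRecession_endgame_generalN_virial.md`, §6: the pointwise half of LEMMA C). If the kinematic momentum `P(t) = ΣMᵢγᵢvᵢ` of a
finite group converges and its INTERNAL ENERGY `K(t) = ΣMᵢγᵢ − √(M_B² + ‖P‖²)` tends to `0`, then EVERY member velocity converges, to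
the common cold velocity `(√(M_B² + ‖P∞‖²))⁻¹P∞` — by `mass_mul_norm_sub_coldVelocity_sq_le` (`Mⱼ‖vⱼ − V̂(t)‖² ≤ 2Γ³K(t)`) and
continuity of the cold velocity in `P`. (The virial argument supplies `K → 0` for confined isolated groups; the window law supplies the
convergence of `P`.) Mathlib-only on top of `…VirialCold`.
-/

noncomputable section

set_option linter.dupNamespace false

open Finset Filter Topology

namespace Summit.FinalStateConjecture.FinalStateConjecture.Theorems.SublinearIsFree.Virial

open Literature.Geometry.Lorentzian

/-- **Cold limit ⇒ velocity convergence.** For a finite group with rest masses `Mᵢ > 0`, velocities `‖vᵢ(t)‖ ≤ k < 1`: if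
`P(t) = ΣMᵢγᵢ(t)vᵢ(t) → P∞` and `K(t) = ΣMᵢγᵢ(t) − √((ΣMᵢ)² + ‖P(t)‖²) → 0`, then `vⱼ(t) → (√((ΣMᵢ)² + ‖P∞‖²))⁻¹P∞` for every
member `j`. [folklore] -/
theorem tendsto_velocity_of_internalEnergy_tendsto_zero' {ι : Type*} (s : Finset ι) (M : ι → ℝ) (v : ι → ℝ → E3) {k : ℝ}
    (hM : ∀ i ∈ s, 0 < M i) (hk0 : 0 ≤ k) (hk1 : k < 1) (hv : ∀ i ∈ s, ∀ t, ‖v i t‖ ≤ k) {Pinf : E3}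
    (hP : Tendsto (fun t ↦ ∑ i ∈ s, (M i * (√(1 - ‖v i t‖ ^ 2))⁻¹) • v i t) atTop (𝓝 Pinf))
    (hK : Tendsto (fun t ↦ ∑ i ∈ s, M i * (√(1 - ‖v i t‖ ^ 2))⁻¹ -
      √((∑ i ∈ s, M i) ^ 2 + ‖∑ i ∈ s, (M i * (√(1 - ‖v i t‖ ^ 2))⁻¹) • v i t‖ ^ 2)) atTop (𝓝 0))
    {j : ι} (hj : j ∈ s) :
    Tendsto (v j) atTop (𝓝 ((√((∑ i ∈ s, M i) ^ 2 + ‖Pinf‖ ^ 2))⁻¹ • Pinf)) := by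
  set MB : ℝ := ∑ i ∈ s, M i with hMB
  set P : ℝ → E3 := fun t ↦ ∑ i ∈ s, (M i * (√(1 - ‖v i t‖ ^ 2))⁻¹) • v i t with hPdef
  set K : ℝ → ℝ := fun t ↦ ∑ i ∈ s, M i * (√(1 - ‖v i t‖ ^ 2))⁻¹ - √(MB ^ 2 + ‖P t‖ ^ 2) with hKdef
  set Vhat : ℝ → E3 := fun t ↦ (√(MB ^ 2 + ‖P t‖ ^ 2))⁻¹ • P t with hVhat
  have hMB0 : 0 < MB := Finset.sum_pos hM ⟨j, hj⟩
  have hMj : 0 < M j := hM j hj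
  set Γ : ℝ := (√(1 - k ^ 2))⁻¹ with hΓ
  -- (1) the cold velocity converges, by continuity
  have hS : Tendsto (fun t ↦ √(MB ^ 2 + ‖P t‖ ^ 2)) atTop (𝓝 (√(MB ^ 2 + ‖Pinf‖ ^ 2))) :=
    ((tendsto_const_nhds.add ((hP.norm).pow 2)).sqrt)
  have hSinf : √(MB ^ 2 + ‖Pinf‖ ^ 2) ≠ 0 := (Real.sqrt_pos.mpr (by positivity)).ne'
  have hV : Tendsto Vhat atTop (𝓝 ((√(MB ^ 2 + ‖Pinf‖ ^ 2))⁻¹ • Pinf)) :=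
    (hS.inv₀ hSinf).smul hP
  -- (2) the deviation from the cold velocity is controlled by `K → 0`
  have hdev : ∀ t, M j * ‖v j t - Vhat t‖ ^ 2 ≤ 2 * Γ ^ 3 * K t := fun t ↦
    mass_mul_norm_sub_coldVelocity_sq_le' s M (fun i ↦ v i t) hM hk0 hk1 (fun i hi ↦ hv i hi t) hj
  have hsq : Tendsto (fun t ↦ ‖v j t - Vhat t‖ ^ 2) atTop (𝓝 0) := by
    have hup : Tendsto (fun t ↦ 2 * Γ ^ 3 * K t / M j) atTop (𝓝 0) := by
      have := (hK.const_mul (2 * Γ ^ 3)).div_const (M j)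
      simpa using this
    refine tendsto_of_tendsto_of_tendsto_of_le_of_le tendsto_const_nhds hup (fun t ↦ sq_nonneg _) fun t ↦ ?_
    rw [le_div_iff₀ hMj, mul_comm]
    exact hdev t
  have hnorm : Tendsto (fun t ↦ ‖v j t - Vhat t‖) atTop (𝓝 0) := by
    have h := hsq.sqrt
    rw [Real.sqrt_zero] at h
    refine h.congr fun t ↦ ?_
    exact Real.sqrt_sq (norm_nonneg _)
  have hdiff : Tendsto (fun t ↦ v j t - Vhat t) atTop (𝓝 0) :=
    tendsto_zero_iff_norm_tendsto_zero.mpr hnorm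
  -- (3) conclude
  have := hdiff.add hV
  simpa using this

/-- Registered stub `tendsto_velocity_of_internalEnergy_tendsto_zero` (crux `stmt-FinalStateConjecture-10166`): cold limit ⇒ every
member velocity converges; one-line form of `tendsto_velocity_of_internalEnergy_tendsto_zero'`. [folklore] -/
theorem tendsto_velocity_of_internalEnergy_tendsto_zero : open Literature.Geometry.Lorentzian Filter Topology in ∀ {ι : Type*} (s : Finset ι) (M : ι → ℝ) (v : ι → ℝ → E3) {k : ℝ}, (∀ i ∈ s, 0 < M i) → 0 ≤ k → k < 1 → (∀ i ∈ s, ∀ t, ‖v i t‖ ≤ k) → ∀ {Pinf : E3}, Tendsto (fun t ↦ ∑ i ∈ s, (M i * (√(1 - ‖v i t‖ ^ 2))⁻¹) • v i t) atTop (𝓝 Pinf) → Tendsto (fun t ↦ ∑ i ∈ s, M i * (√(1 - ‖v i t‖ ^ 2))⁻¹ - √((∑ i ∈ s, M i) ^ 2 + ‖∑ i ∈ s, (M i * (√(1 - ‖v i t‖ ^ 2))⁻¹) • v i t‖ ^ 2)) atTop (𝓝 0) → ∀ {j : ι}, j ∈ s → Tendsto (v j) atTop (𝓝 ((√((∑ i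 ∈ s, M i) ^ 2 + ‖Pinf‖ ^ 2))⁻¹ • Pinf)) :=
  fun s M v _ hM hk0 hk1 hv _ hP hK _ hj ↦ tendsto_velocity_of_internalEnergy_tendsto_zero' s M v hM hk0 hk1 hv hP hK hj

end Summit.FinalStateConjecture.FinalStateConjecture.Theorems.SublinearIsFree.Virial

end
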